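import Summits.ABC.IUTFork.Cor312PinnedThetaRealSharpNegative
import Summits.ABC.IUTFork.Thm311RealIsmDHMoverCriterion
import HarnessLib

/-!
# [IUTchIII] Cor. 3.12 — PR-1's Θ-PIN at the sharp real settings: the NEGATIVE from ANY (Ind2) mover of the unit
# ball, hence at EVERY tame place `2 ≤ e(v₀|p₀) ≤ p₀ − 2` (any residue degree) and at every place whose unit ball is
# no `p₀^k·log_{p₀}(𝒪_{v₀}^×)`

PROOF-ONLY sequel (0 definitions, 0 named facts; abc-iut cell, WAVE-5 prover seat abc-iut-w5-d044, gen 5; by-name sequel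
«NEG-PIN-GENERAL-E» inside the Team R «ismDH mover» record) to abc-iut-w4-d087's `Cor312PinnedThetaRealSharpNegative`
(p430919) and abc-iut-w5-d180's BALL-MOVER CRITERION `Thm311RealIsmDHMoverCriterion` (p432150). TAKES NO SIDE on
[IUTchIII] Cor. 3.12.

WHAT CHANGES. w4-d087's §2 feeds the Θ-pin algebra (under PR-1's (hρ)+(pΘ) a star-trivial indeterminacy fixes every
Θ-region) with ONE explicit (Ind2) generator, w5-d216's rank-2 swap mover at a tame QUADRATICALLY ramified place
(`e = 2`, `f = 1`, `p₀ ≥ 5`); the plumbing only uses that `ψ ∈ Real.ismDH (analyticLogv F) (inr v₀)` MOVES THE UNIT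
BALL `𝒪_{v₀}`. §1 is that proof with the mover ABSTRACTED (no uniformizer, no `(e, f)` hypothesis); §2 the Θ-pin /
`PinnedRegions` / `PinnedRegions3` negatives at `Real.settingDHVolSharp` from any such mover; §3 the instances supplied by
w5-d180's criterion — TAME: `p₀` odd, `2 ≤ e(v₀|p₀) ≤ p₀ − 2`, ANY `f` (`exists_mem_ismDH_image_closedBall_ne_of_tame` at
`t = 1`, `j = 0`: `log_{p₀}(𝒪^×) = 𝔪` and `e ∤ −1`), and WILD-INCLUSIVE: the unit ball of `K_{v₀}` is no
`p₀^k·log_{p₀}(𝒪_{v₀}^×)` (`exists_mem_ismDH_image_closedBall_ne_of_forall_ne`). The transports to the print-normalised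
`Real.settingPrVolSharp` (p431122's `rfl`) are left to a sequel. CRITERION OF RECORD (p432150 over campaign-S
`LatticeAutStableSubgroups`): a DH-(Ind2) mover of the unit ball at `v₀` EXISTS iff `𝒪_{v₀} ∉ p₀^ℤ·log_{p₀}(𝒪_{v₀}^×)`;
in the tame range this is `e(v₀|p₀) ≥ 2`, and NO mover exists at unramified odd places
(`forall_ismDH_image_closedBall_eq_of_unramified`) — «tame quadratic» was a special case, not the phenomenon.

READING (neutral, as in the parents): under DH's (Ind2) (`Aut_{ℚ_p}(K_v : I_v)`) the idele-box Θ-regions cannot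
instantiate print's Θ-pin at such `F` (the (Ind2)-stable lattice boxes / the isometry reading are the pin-compatible
readings); for branch C, `hPin : PinnedRegions(3)` AT these settings is jointly UNSATISFIABLE at every such `F` (vacuity
guard, now at every tame `e ≥ 2`). HONEST SCOPE: OUR interface + OUR sharp real containers under ONE reading of (Ind2);
nothing bears on print's (xi-e)/(xi-f). [claim: Mochizuki2012, status: disputed]; [cite: DupuyHilado2025, §3.9, §4.9];
[cite: ScholzeStix2018, §2.2 pp. 9–10]; [cite: WeilBNT1967, Ch. II §2, Th. 1–2]. Consumed BY NAME, nothing restated: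
`Cor312Vol.image_thetaRegion_eq_of_thetaPinned`, `labelIdele_zero`, `over_ne_of_residueChar_ne` (w4-d087),
`exists_mem_ismDH_image_closedBall_ne_of_tame` / `…_of_forall_ne` (w5-d180), `IsmDHMover.*` (w5-d216), `presAt` / `toR` /
`ofR` (c312-5), `mem_integers_iff_norm_rescaled_le_one` (L5-t5). typed ≠ proved; instantiated ≠ endorsed.
-/

noncomputable section

open Metric Set
open scoped Pointwise
namespace Summit.ABC.IUTFork.Thm311.Real

open Cor312 Cor312Vol Literature.IUT.LogThetaLattice Literature.IUT.LogVolume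
  Literature.NumberTheory.NumberFields Literature.NumberTheory.GaloisRepresentations.Ultrametric
  NumberField IsDedekindDomain

section Assembled

variable {F : Type} [Field F] [NumberField F] (X : PilotData F)
  (M : Type) [Field M] [NumberField M]
  (archPk : ∀ (j : (thetaIndex X).Label) (vQ : (thetaIndex X).VQ),
    Set ((logShellsDH X (analyticLogv F)).Packet j vQ))
  (archSub : ∀ (j : (thetaIndex X).Label) (v : (thetaIndex X).V),
    Set ((logShellsDH X (analyticLogv F)).Packet j ((thetaIndex X).over v)))
  (Ψ : ℤ → ∀ v : (thetaIndex X).V, v ∈ (thetaIndex X).Vbad → Set ((logShellsDH X (analyticLogv F)).StarPacket v))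
  (act : ℤ → ∀ v : (thetaIndex X).V, v ∈ (thetaIndex X).Vbad →
    (logShellsDH X (analyticLogv F)).StarPacket v →
      Module.End ℚ ((logShellsDH X (analyticLogv F)).StarPacket v))
  (Mmod : ℤ → ∀ j : (thetaIndex X).LabelStar, Set ((logShellsDH X (analyticLogv F)).GlobalPacket j.1))
  (region : ℤ → ∀ j : (thetaIndex X).LabelStar, FinDivisor M → ∀ vQ : (thetaIndex X).VQ,
    Set ((logShellsDH X (analyticLogv F)).Packet j.1 vQ))
  (n : ℤ) {HT : Type} {LogLink : HT → HT → Type} {IsFull : ∀ {s t : HT}, LogLink s t → Prop}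
  (lat : LGPGaussianLogThetaLattice LogLink IsFull)
  {Frd : Type} {IsoF : Frd → Frd → Type} {Ob : Frd → Type} {realify : Frd → Frd} {Strip : Type}
  {IsoS : Strip → Strip → Type} {Mv : ∀ v : (thetaIndex X).V, v ∈ (thetaIndex X).Vbad → Type}
  [∀ v h, Monoid (Mv v h)]
  (sig : GlobalLGPFrobenioidSignature (thetaIndex X).lstar (thetaIndex X).V (· ∈ (thetaIndex X).Vbad)
    Frd IsoF Ob realify Strip IsoS Mv)
  (split : SplittingMonoids Mv) {ObΔ : Type} {N : ∀ v : (thetaIndex X).V, v ∈ (thetaIndex X).Vbad → Type}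
  [∀ v h, Monoid (N v h)] (qData : QPilotData ObΔ N)
  (tq : ∀ (pp : Nat.Primes) (x : (thetaIndex X).Fibre (.inr pp)),
    haveI : Fact (pp : ℕ).Prime := ⟨pp.2⟩; kOf X pp.1 x)
  (t : ∀ (pp : Nat.Primes) (_ : Fin X.lstar) (x : (thetaIndex X).Fibre (.inr pp)),
    haveI : Fact (pp : ℕ).Prime := ⟨pp.2⟩; kOf X pp.1 x)
  (htq0 : ∀ pp x, tq pp x ≠ 0)
  (htq1 : ∀ (pp : Nat.Primes) (x : (thetaIndex X).Fibre (.inr pp)),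
    haveI : Fact (pp : ℕ).Prime := ⟨pp.2⟩; placeOf X pp.1 x ∉ X.S → ‖tq pp x‖ = 1)

/-! ## §1. The one-place (Ind2) generator from ANY mover of the unit ball -/

/-- **THE ONE-PLACE DUPUY–HILADO GENERATOR, ABSTRACT MOVER.** If at a finite place `v₀` over `p₀` SOME
`ψ ∈ Real.ismDH (analyticLogv F) (inr v₀)` (a bicontinuous `ℚ`-linear automorphism of `K_{v₀}` fixing the log-shell)
MOVES the unit ball `𝒪_{v₀}`, then the (Ind2)-generator «`ψ` at `v₀`, the identity at every other place» of
abc-iut-c312-5's signature `logShellsDH X (analyticLogv F)` (a) is the IDENTITY on every star packet over a rational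
place `≠ p₀`, and (b) MOVES the label-`0` Θ-region of `Real.settingDHVolSharp` at `(0, p₀)` — the preimage
`e⁻¹(Π_{v⃗} (R_I)^∼)` of the unit boxes — for every `m`. [cite: DupuyHilado2025, §3.9, §4.9] [claim: Mochizuki2012, status: disputed] -/
theorem exists_ind2_starTrivial_moves_thetaRegion_zero_settingDHVolSharp_of_exists_mover
    (pp : Nat.Primes) (v₀ : HeightOneSpectrum (𝓞 F)) (hv₀ : (thetaIndex X).over (.inr v₀) = .inr pp)
    (hmov : ∃ ψ ∈ ismDH (analyticLogv F) (.inr v₀ : Place F),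
      ⇑ψ '' (integers v₀ : Set (Carrier (.inr v₀ : Place F))) ≠ integers v₀) :
    ∃ Φ₀ ∈ (logShellsDH X (analyticLogv F)).Ind2Family,
      (∀ v : (thetaIndex X).V, (thetaIndex X).over v ≠ .inr pp →
        (logShellsDH X (analyticLogv F)).starAut Φ₀ v = LinearEquiv.refl ℚ _) ∧
      ∀ m : ℤ, ⇑(Φ₀ 0 (.inr pp)) ''
          (settingDHVolSharp X (logvAnalytic_analyticLogv (F := F)) M archPk archSub Ψ act Mmod region n lat sig
            split qData tq t htq0 htq1).thetaRegion m 0 (.inr pp) ≠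
        (settingDHVolSharp X (logvAnalytic_analyticLogv (F := F)) M archPk archSub Ψ act Mmod region n lat sig
            split qData tq t htq0 htq1).thetaRegion m 0 (.inr pp) := by
  classical
  haveI hpF : Fact (pp : ℕ).Prime := ⟨pp.2⟩
  haveI : Fintype ((thetaIndex X).Fibre (.inr pp)) := Fintype.ofFinite _
  set K := kOf X pp.1 ⟨.inr v₀, hv₀⟩
  have hlog : LogvAnalytic (analyticLogv F) := logvAnalytic_analyticLogv (F := F)
  let L := logShellsDH X (analyticLogv F)
  set x₀ : (thetaIndex X).Fibre (.inr pp) := ⟨.inr v₀, hv₀⟩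
  set P := presAt X hlog pp
  have hlab : (((0 : (thetaIndex X).Label)) : ℕ) = 0 := Fin.val_zero _
  have hv : ((pp : ℕ) : 𝓞 F) ∈ v₀.asIdeal := natCast_mem_placeOf X pp x₀
  -- the identity `Carrier (.inr v₀) ≃ K_v₀^{(1/n)}`
  let e : Carrier (.inr v₀ : Place F) ≃+* K := RescaledCompletion.of F pp v₀ hv
  -- the mover on the carrier, given abstractly
  obtain ⟨ψ, hψmem, hψBc⟩ := hmov
  -- the unit ball `B := 𝒪_{v₀}`, read through `e` as `‖e z‖ ≤ 1`
  set Bc : Set (Carrier (.inr v₀ : Place F)) := (integers v₀ : Set (Carrier (.inr v₀ : Place F))) with hBc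
  have hmem_Bc : ∀ z : Carrier (.inr v₀ : Place F), z ∈ Bc ↔ ‖e z‖ ≤ 1 := fun z =>
    mem_integers_iff_norm_rescaled_le_one F pp v₀ hv (e z)
  -- the (Ind2)-generator: `ψ` at `v₀`, the identity elsewhere
  let gPl : ∀ y : Place F, Carrier y ≃ₗ[ℚ] Carrier y := fun y =>
    if h : y = .inr v₀ then (by subst h; exact ψ) else LinearEquiv.refl ℚ (Carrier y)
  have hgPl_v₀ : gPl (.inr v₀) = ψ := by
    show (if h : (Sum.inr v₀ : Place F) = .inr v₀ then _ else _) = ψ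
    rw [dif_pos rfl]
  have hgPl_ne : ∀ y : Place F, y ≠ .inr v₀ → gPl y = LinearEquiv.refl ℚ (Carrier y) := by
    intro y hy
    show (if h : y = .inr v₀ then _ else _) = _
    rw [dif_neg hy]
  have hgPl_mem : ∀ y : Place F, gPl y ∈ ismDH (analyticLogv F) y := by
    intro y
    by_cases hy : y = .inr v₀
    · subst hy; rw [hgPl_v₀]; exact hψmem
    · rw [hgPl_ne y hy]; exact refl_mem_ismDH _ y
  let Φ₀ : L.PacketAut := fun j vQ => L.factorwise j vQ fun _ => L.summandwise vQ fun v => gPl v.1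
  have hΦ₀ : Φ₀ ∈ L.Ind2Family := fun j vQ =>
    ⟨fun _ v => gPl v.1, fun _ v => hgPl_mem v.1, rfl⟩
  refine ⟨Φ₀, hΦ₀, ?_, ?_⟩
  · -- (a) star-triviality off `p₀`: every summand over `v_ℚ ≠ p₀` is a place `≠ v₀`
    intro v hover
    apply LinearEquiv.ext
    intro x
    funext j'
    show (Φ₀ j'.1 ((thetaIndex X).over v)) (x j') = x j'
    have hw : ∀ w : (thetaIndex X).Fibre ((thetaIndex X).over v), gPl w.1 = LinearEquiv.refl ℚ (Carrier w.1) := by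
      intro w
      refine hgPl_ne w.1 fun hw1 => hover ?_
      rw [← w.2, hw1, hv₀]
    have hΦv : Φ₀ j'.1 ((thetaIndex X).over v) = LinearEquiv.refl ℚ _ := by
      show L.factorwise j'.1 ((thetaIndex X).over v)
          (fun _ => L.summandwise ((thetaIndex X).over v) fun w => gPl w.1) = _
      have hg : (fun w : (thetaIndex X).Fibre ((thetaIndex X).over v) => gPl w.1) =
          fun w : (thetaIndex X).Fibre ((thetaIndex X).over v) => LinearEquiv.refl ℚ (L.carrier w.1) := by
        funext w; exact hw w
      rw [hg, L.summandwise_refl_family, L.factorwise_refl]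
    rw [hΦv]
    rfl
  · -- (b) the label-0 Θ-region at `(0, p₀)` is moved
    intro m
    -- the region, in the real prime packet: `comparison⁻¹ Π_{v⃗} ι_last(1)·(R_I)^∼`
    have hR : (settingDHVolSharp X hlog M archPk archSub Ψ act Mmod region n lat sig split qData tq t htq0
          htq1).thetaRegion m 0 (.inr pp) =
        P.comparison 0 ⁻¹' Set.pi univ fun ev =>
          iota pp.1 (P.kk ev) (Fin.last _) (labelIdele X t pp 0 (ev (Fin.last _))) •
            (normalizedPacket pp.1 (P.kk ev) : Set (P.X ev)) := by
      change (fun x => P.factorMap 0 x) ⁻¹' P.boxOf (sharpBoxDH X hlog t pp 0) = _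
      rw [P.factorMap_preimage_boxOf]
      rfl
    rw [hR]
    have hc1 : ∀ x : (thetaIndex X).Fibre (.inr pp), labelIdele X t pp 0 x = 1 := labelIdele_zero X t pp
    have hc0 : ∀ x : (thetaIndex X).Fibre (.inr pp), labelIdele X t pp 0 x ≠ 0 := fun x => by
      rw [hc1]; exact one_ne_zero
    have hck : ‖labelIdele X t pp 0 x₀‖ = 1 := by rw [hc1, norm_one]
    -- test vectors: for `z ∈ K_{v₀}` the pure tensor with `z` at `v₀` and `1` elsewhere (one tensor slot at label 0)
    let y1 : Carrier (.inr v₀ : Place F) → L.Packet1 (.inr pp) := fun z =>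
      Function.update (fun v => (P.φ v).symm (labelIdele X t pp 0 v)) x₀ z
    have hy1_x₀ : ∀ z, y1 z x₀ = z := fun z => Function.update_self _ _ _
    have hy1_ne : ∀ z (v : (thetaIndex X).Fibre (.inr pp)), v ≠ x₀ →
        y1 z v = (P.φ v).symm (labelIdele X t pp 0 v) :=
      fun z v hv' => Function.update_of_ne hv' _ _
    let xz : Carrier (.inr v₀ : Place F) → L.Packet 0 (.inr pp) := fun z => L.tprod 0 (.inr pp) fun _ => y1 z
    -- membership of the test vectors: decided at the constant tuple `v⃗ = (v₀)`, where it reads `‖z‖ ≤ 1`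
    have hφx₀ : ∀ z : Carrier (.inr v₀ : Place F), P.φ x₀ z = e z := fun z => rfl
    have hall : ∀ z, ‖e z‖ ≤ 1 →
        ∀ v : (thetaIndex X).Fibre (.inr pp), ‖P.φ v (y1 z v)‖ ≤ ‖labelIdele X t pp 0 v‖ := by
      intro z hz v
      by_cases hv' : v = x₀
      · subst hv'
        rw [hy1_x₀, hφx₀]
        exact hz.trans_eq hck.symm
      · rw [hy1_ne z v hv', LinearEquiv.apply_symm_apply]
        exact le_rfl
    have hmem_xz : ∀ z, xz z ∈ P.comparison 0 ⁻¹' (Set.pi univ fun ev =>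
        iota pp.1 (P.kk ev) (Fin.last _) (labelIdele X t pp 0 (ev (Fin.last _))) •
          (normalizedPacket pp.1 (P.kk ev) : Set (P.X ev))) ↔ z ∈ Bc := by
      intro z
      rw [hmem_Bc, Set.mem_preimage, Set.mem_univ_pi]
      constructor
      · intro h
        have h0 := h (fun _ => x₀)
        rw [show P.comparison 0 (xz z) (fun _ => x₀) = _ from P.comparison_tprod 0 (fun _ => y1 z) (fun _ => x₀),
          IsmDHMover.tprod_eq_iota_last _ hlab,
          IsmDHMover.iota_mem_smul_normalizedPacket_iff pp.1 (P.kk fun _ => x₀) (Fin.last _) (hc0 x₀),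
          hy1_x₀, hφx₀] at h0
        exact h0.trans_eq hck
      · intro hz ev
        rw [show P.comparison 0 (xz z) ev = _ from P.comparison_tprod 0 (fun _ => y1 z) ev,
          IsmDHMover.tprod_eq_iota_last _ hlab,
          IsmDHMover.iota_mem_smul_normalizedPacket_iff pp.1 (P.kk ev) (Fin.last _) (hc0 (ev (Fin.last _)))]
        exact hall z hz (ev (Fin.last _))
    -- the generator acts on the test vectors by `ψ` at `v₀`
    have hΦxz : ∀ z, Φ₀ 0 (.inr pp) (xz z) = xz (ψ z) := by
      intro z
      show L.factorwise 0 (.inr pp) (fun _ => L.summandwise (.inr pp) fun v => gPl v.1)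
          (L.tprod 0 (.inr pp) fun _ => y1 z) = L.tprod 0 (.inr pp) fun _ => y1 (ψ z)
      rw [L.factorwise_summandwise_tprod]
      congr 1
      funext a v
      by_cases hv' : v = x₀
      · rw [hv', hy1_x₀, hy1_x₀]
        show gPl (.inr v₀) z = ψ z
        rw [hgPl_v₀]
      · have hv1 : v.1 ≠ .inr v₀ := fun h => hv' (Subtype.ext h)
        rw [hy1_ne z _ hv', hy1_ne (ψ z) _ hv', hgPl_ne v.1 hv1]
        rfl
    intro hEq
    have key : ∀ x, x ∈ _ ↔ Φ₀ 0 (.inr pp) x ∈ _ := fun x =>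
      ((Φ₀ 0 (.inr pp)).injective.mem_set_image).symm.trans (Set.ext_iff.mp hEq (Φ₀ 0 (.inr pp) x))
    rcases IsmDHMover.exists_of_image_ne ψ.toEquiv hψBc with ⟨z, hz, hψz⟩ | ⟨z, hz, hψz⟩
    · -- `z ∈ B`, `ψ z ∉ B`: `x_z` lies in the region, `Φ₀ x_z = x_{ψ z}` does not
      have h1 : Φ₀ 0 (.inr pp) (xz z) ∈ _ := (key (xz z)).mp ((hmem_xz z).mpr hz)
      have h2 := (hΦxz z) ▸ h1
      exact hψz ((hmem_xz (ψ z)).mp h2)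
    · -- `z ∉ B`, `ψ z ∈ B`: `x_{ψ z} = Φ₀ x_z` lies in the (Φ₀-stable) region, so `x_z` does
      have h1 : xz (ψ z) ∈ _ := (hmem_xz (ψ z)).mpr hψz
      have h2 := (hΦxz z).symm ▸ h1
      exact hz ((hmem_xz z).mp ((key (xz z)).mpr h2))

/-! ## §2. The Θ-pin is unsatisfiable at `Real.settingDHVolSharp` from any mover of the unit ball -/

variable (col : ℤ → Column (logShellsDH X (analyticLogv F)))
  (ρ : (∀ v : (thetaIndex X).V, v ∈ (thetaIndex X).Vbad → Set ((logShellsDH X (analyticLogv F)).StarPacket v)) →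
    ∀ (j : (thetaIndex X).Label) (vQ : (thetaIndex X).VQ), Set ((logShellsDH X (analyticLogv F)).Packet j vQ))
  (qK : ∀ v : (thetaIndex X).V, v ∈ (thetaIndex X).Vbad → Set ((logShellsDH X (analyticLogv F)).StarPacket v))

/-- **PR-1's Θ-PIN FAILS, FOR EVERY region-forming operator `ρ`, at `Real.settingDHVolSharp`** (analytic logarithms,
any ideles / context binders / columns) as soon as at ONE finite place `v₀` over a prime `p₀` carrying NO place of `S`
some `ψ ∈ Real.ismDH (analyticLogv F) (inr v₀)` moves the unit ball `𝒪_{v₀}`.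
[cite: DupuyHilado2025, §4.9] [claim: Mochizuki2012, status: disputed] -/
theorem not_thetaPinned_settingDHVolSharp_of_exists_mover
    (pp : Nat.Primes) (v₀ : HeightOneSpectrum (𝓞 F)) (hv₀ : (thetaIndex X).over (.inr v₀) = .inr pp)
    (hmov : ∃ ψ ∈ ismDH (analyticLogv F) (.inr v₀ : Place F),
      ⇑ψ '' (integers v₀ : Set (Carrier (.inr v₀ : Place F))) ≠ integers v₀)
    (hS : ∀ v ∈ (thetaIndex X).Vbad, (thetaIndex X).over v ≠ .inr pp) :
    ¬ ThetaPinned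
        ({ toSituation := situationDHVol X (logvAnalytic_analyticLogv (F := F)) M archPk archSub Ψ act Mmod region,
           col := col } : LatticeSituation (thetaIndex X))
        (settingDHVolSharp X (logvAnalytic_analyticLogv (F := F)) M archPk archSub Ψ act Mmod region n lat sig
          split qData tq t htq0 htq1) ρ := by
  intro hpin
  obtain ⟨Φ₀, hΦ₀, hstar, hmv⟩ :=
    exists_ind2_starTrivial_moves_thetaRegion_zero_settingDHVolSharp_of_exists_mover X M archPk archSub Ψ act Mmod
      region n lat sig split qData tq t htq0 htq1 pp v₀ hv₀ hmov
  refine hmv 0 (Cor312Vol.image_thetaRegion_eq_of_thetaPinned hpin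
    (Subgroup.subset_closure (Set.mem_union_right _ hΦ₀)) ?_ 0 0 (.inr pp))
  intro v hv A
  have h := hstar v (hS v hv)
  change ⇑((logShellsDH X (analyticLogv F)).starAut Φ₀ v) '' A = A
  rw [h]
  exact Set.image_id' A

/-- … hence PR-1's two pins `PinnedRegions` (branch C v2's `hPin` shape) fail there for every `ρ`, `qK`.
[claim: Mochizuki2012, status: disputed] -/
theorem not_pinnedRegions_settingDHVolSharp_of_exists_mover
    (pp : Nat.Primes) (v₀ : HeightOneSpectrum (𝓞 F)) (hv₀ : (thetaIndex X).over (.inr v₀) = .inr pp)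
    (hmov : ∃ ψ ∈ ismDH (analyticLogv F) (.inr v₀ : Place F),
      ⇑ψ '' (integers v₀ : Set (Carrier (.inr v₀ : Place F))) ≠ integers v₀)
    (hS : ∀ v ∈ (thetaIndex X).Vbad, (thetaIndex X).over v ≠ .inr pp) :
    ¬ PinnedRegions
        ({ toSituation := situationDHVol X (logvAnalytic_analyticLogv (F := F)) M archPk archSub Ψ act Mmod region,
           col := col } : LatticeSituation (thetaIndex X))
        (settingDHVolSharp X (logvAnalytic_analyticLogv (F := F)) M archPk archSub Ψ act Mmod region n lat sig
          split qData tq t htq0 htq1) ρ qK := fun h =>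
  not_thetaPinned_settingDHVolSharp_of_exists_mover X M archPk archSub Ψ act Mmod region n lat sig split qData tq t
    htq0 htq1 col ρ pp v₀ hv₀ hmov hS h.1

/-- … and `PinnedRegions3` (two pins ∧ link pin) at `Real.settingDHVolSharp`. [claim: Mochizuki2012, status: disputed] -/
theorem not_pinnedRegions3_settingDHVolSharp_of_exists_mover
    (pp : Nat.Primes) (v₀ : HeightOneSpectrum (𝓞 F)) (hv₀ : (thetaIndex X).over (.inr v₀) = .inr pp)
    (hmov : ∃ ψ ∈ ismDH (analyticLogv F) (.inr v₀ : Place F),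
      ⇑ψ '' (integers v₀ : Set (Carrier (.inr v₀ : Place F))) ≠ integers v₀)
    (hS : ∀ v ∈ (thetaIndex X).Vbad, (thetaIndex X).over v ≠ .inr pp) :
    ¬ PinnedRegions3
        ({ toSituation := situationDHVol X (logvAnalytic_analyticLogv (F := F)) M archPk archSub Ψ act Mmod region,
           col := col } : LatticeSituation (thetaIndex X))
        (settingDHVolSharp X (logvAnalytic_analyticLogv (F := F)) M archPk archSub Ψ act Mmod region n lat sig
          split qData tq t htq0 htq1) ρ qK := fun h =>
  not_pinnedRegions_settingDHVolSharp_of_exists_mover X M archPk archSub Ψ act Mmod region n lat sig split qData tq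
    t htq0 htq1 col ρ qK pp v₀ hv₀ hmov hS h.1

/-! ## §3. Movers of the unit ball supplied by the BALL-MOVER CRITERION (abc-iut-w5-d180, p432150) -/

/-- Dictionary: a `g ∈ Real.ismDH` moving the unit ball of the rescaled completion (w5-d180's currency, through the
identities `toR`/`ofR`) moves `𝒪_{v₀} ⊆ K_{v₀}` (this file's currency) — the same set in the same type
(`mem_integers_iff_norm_rescaled_le_one`). [folklore] -/
theorem exists_ismDH_image_integers_ne_of_image_closedBall_ne (pp : Nat.Primes) (v₀ : HeightOneSpectrum (𝓞 F))
    (hv : ((pp : ℕ) : 𝓞 F) ∈ v₀.asIdeal)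
    (h : ∃ g ∈ ismDH (analyticLogv F) (.inr v₀ : Place F),
      (fun a => toR (pp : ℕ) v₀ hv (g (ofR (pp : ℕ) v₀ hv a))) ''
          closedBall (0 : RescaledCompletion F pp v₀ hv) 1 ≠ closedBall 0 1) :
    ∃ ψ ∈ ismDH (analyticLogv F) (.inr v₀ : Place F),
      ⇑ψ '' (integers v₀ : Set (Carrier (.inr v₀ : Place F))) ≠ integers v₀ := by
  haveI : Fact (pp : ℕ).Prime := ⟨pp.2⟩
  obtain ⟨g, hg, hne⟩ := h
  have hS : (integers v₀ : Set (Carrier (.inr v₀ : Place F))) = closedBall (0 : RescaledCompletion F pp v₀ hv) 1 :=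
    Set.ext fun z => (mem_integers_iff_norm_rescaled_le_one F pp v₀ hv z).trans mem_closedBall_zero_iff.symm
  refine ⟨g, hg, fun hEq => hne ?_⟩
  rw [← hS]
  exact hEq

/-- **TAME PLACES, ANY RESIDUE DEGREE**: at a finite place `v₀` over an odd prime `p₀` with `2 ≤ e(v₀|p₀) ≤ p₀ − 2`
some `ψ ∈ Real.ismDH (analyticLogv F) (inr v₀)` moves the unit ball (w5-d180's
`exists_mem_ismDH_image_closedBall_ne_of_tame` at `t = 1`, `j = 0`: `log_{p₀}(𝒪^×) = 𝔪`, and `e ∤ −1`).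
[cite: DupuyHilado2025, §4.9] [cite: WeilBNT1967, Ch. II §2, Th. 1–2] -/
theorem exists_ismDH_image_integers_ne_of_tame (pp : Nat.Primes) (hp2 : 2 < (pp : ℕ))
    (v₀ : HeightOneSpectrum (𝓞 F)) (hv : ((pp : ℕ) : 𝓞 F) ∈ v₀.asIdeal)
    (he2 : 2 ≤ v₀.asIdeal.ramificationIdx ℤ) (hep : v₀.asIdeal.ramificationIdx ℤ ≤ (pp : ℕ) - 2) :
    ∃ ψ ∈ ismDH (analyticLogv F) (.inr v₀ : Place F),
      ⇑ψ '' (integers v₀ : Set (Carrier (.inr v₀ : Place F))) ≠ integers v₀ := by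
  haveI : Fact (pp : ℕ).Prime := ⟨pp.2⟩
  obtain ⟨ϖ, hϖ, -⟩ := exists_isUniformizer_rescaledCompletion F (pp : ℕ) v₀ hv
  have hj : ¬ ((v₀.asIdeal.ramificationIdx ℤ : ℕ) : ℤ) ∣ ((0 : ℤ) - 1) := by
    intro hd
    rw [zero_sub, Int.dvd_neg] at hd
    have h1 := Int.eq_one_of_dvd_one (by positivity) hd
    omega
  have h := exists_mem_ismDH_image_closedBall_ne_of_tame (logvAnalyticAt_analyticLogv (F := F) (pp : ℕ)) hp2 hep
    hϖ (t := 1) (j := 0) (by rw [norm_one, zpow_zero]) hj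
  rw [norm_one] at h
  exact exists_ismDH_image_integers_ne_of_image_closedBall_ne pp v₀ hv h

/-- **ANY RESIDUE CHARACTERISTIC, WILD INCLUDED**: if the unit ball of `K_{v₀}` is no `p₀^k·log_{p₀}(𝒪_{v₀}^×)`
(`k ∈ ℤ`), some `ψ ∈ Real.ismDH (analyticLogv F) (inr v₀)` moves it (w5-d180's
`exists_mem_ismDH_image_closedBall_ne_of_forall_ne` at `t = 1`). [cite: DupuyHilado2025, §4.9] [cite: WeilBNT1967, Ch. II §2, Th. 1–2] -/
theorem exists_ismDH_image_integers_ne_of_forall_ne (pp : Nat.Primes) (v₀ : HeightOneSpectrum (𝓞 F))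
    (hv : ((pp : ℕ) : 𝓞 F) ∈ v₀.asIdeal)
    (hne : haveI : Fact (pp : ℕ).Prime := ⟨pp.2⟩
      ∀ k : ℤ, closedBall (0 : RescaledCompletion F pp v₀ hv) 1 ≠
        (((pp : ℕ) : ℚ_[pp]) ^ k) •
          (Literature.IUT.LogVolume.logUnits (RescaledCompletion F pp v₀ hv) : Set (RescaledCompletion F pp v₀ hv))) :
    ∃ ψ ∈ ismDH (analyticLogv F) (.inr v₀ : Place F),
      ⇑ψ '' (integers v₀ : Set (Carrier (.inr v₀ : Place F))) ≠ integers v₀ := by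
  haveI : Fact (pp : ℕ).Prime := ⟨pp.2⟩
  have h := exists_mem_ismDH_image_closedBall_ne_of_forall_ne (logvAnalyticAt_analyticLogv (F := F) (pp : ℕ)) v₀ hv
    (t := 1) one_ne_zero (by rw [norm_one]; exact hne)
  rw [norm_one] at h
  exact exists_ismDH_image_integers_ne_of_image_closedBall_ne pp v₀ hv h

/-- **PR-1's Θ-PIN FAILS at `Real.settingDHVolSharp` as soon as `F` has ONE tame place `v₀` — odd `p₀`,
`2 ≤ e(v₀|p₀) ≤ p₀ − 2`, ANY residue degree — with no place of `S` over `p₀`** (w4-d087's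
`not_pinnedRegions3_settingDHVolSharp` was `e = 2`, `f = 1`, `p₀ ≥ 5`); for every `ρ`, `qK`, ideles, context
binders, columns (concrete `S`-form: feed `over_ne_of_residueChar_ne X pp hS`).
[cite: DupuyHilado2025, §4.9] [claim: Mochizuki2012, status: disputed] -/
theorem not_pinnedRegions3_settingDHVolSharp_of_tame
    (pp : Nat.Primes) (hp2 : 2 < (pp : ℕ)) (v₀ : HeightOneSpectrum (𝓞 F))
    (hv₀ : (thetaIndex X).over (.inr v₀) = .inr pp)
    (he2 : 2 ≤ v₀.asIdeal.ramificationIdx ℤ) (hep : v₀.asIdeal.ramificationIdx ℤ ≤ (pp : ℕ) - 2)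
    (hS : ∀ v ∈ (thetaIndex X).Vbad, (thetaIndex X).over v ≠ .inr pp) :
    ¬ PinnedRegions3
        ({ toSituation := situationDHVol X (logvAnalytic_analyticLogv (F := F)) M archPk archSub Ψ act Mmod region,
           col := col } : LatticeSituation (thetaIndex X))
        (settingDHVolSharp X (logvAnalytic_analyticLogv (F := F)) M archPk archSub Ψ act Mmod region n lat sig
          split qData tq t htq0 htq1) ρ qK :=
  haveI : Fact (pp : ℕ).Prime := ⟨pp.2⟩
  not_pinnedRegions3_settingDHVolSharp_of_exists_mover X M archPk archSub Ψ act Mmod region n lat sig split qData tq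
    t htq0 htq1 col ρ qK pp v₀ hv₀
    (exists_ismDH_image_integers_ne_of_tame pp hp2 v₀ (natCast_mem_placeOf X pp ⟨.inr v₀, hv₀⟩) he2 hep) hS

/-- **PR-1's Θ-PIN FAILS at `Real.settingDHVolSharp` — wild ramification included — as soon as `F` has ONE finite
place `v₀`, with no place of `S` over its prime `p₀`, whose unit ball is no `p₀^k·log_{p₀}(𝒪_{v₀}^×)`**.
[cite: DupuyHilado2025, §4.9] [claim: Mochizuki2012, status: disputed] -/
theorem not_pinnedRegions3_settingDHVolSharp_of_forall_ne
    (pp : Nat.Primes) (v₀ : HeightOneSpectrum (𝓞 F)) (hv₀ : (thetaIndex X).over (.inr v₀) = .inr pp)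
    (hv : ((pp : ℕ) : 𝓞 F) ∈ v₀.asIdeal)
    (hne : haveI : Fact (pp : ℕ).Prime := ⟨pp.2⟩
      ∀ k : ℤ, closedBall (0 : RescaledCompletion F pp v₀ hv) 1 ≠
        (((pp : ℕ) : ℚ_[pp]) ^ k) •
          (Literature.IUT.LogVolume.logUnits (RescaledCompletion F pp v₀ hv) : Set (RescaledCompletion F pp v₀ hv)))
    (hS : ∀ v ∈ (thetaIndex X).Vbad, (thetaIndex X).over v ≠ .inr pp) :
    ¬ PinnedRegions3
        ({ toSituation := situationDHVol X (logvAnalytic_analyticLogv (F := F)) M archPk archSub Ψ act Mmod region,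
           col := col } : LatticeSituation (thetaIndex X))
        (settingDHVolSharp X (logvAnalytic_analyticLogv (F := F)) M archPk archSub Ψ act Mmod region n lat sig
          split qData tq t htq0 htq1) ρ qK :=
  not_pinnedRegions3_settingDHVolSharp_of_exists_mover X M archPk archSub Ψ act Mmod region n lat sig split qData tq
    t htq0 htq1 col ρ qK pp v₀ hv₀ (exists_ismDH_image_integers_ne_of_forall_ne pp v₀ hv hne) hS

end Assembled
end Summit.ABC.IUTFork.Thm311.Real
end
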